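import Summits.KontsevichZagierPeriods.Zeta5Search.Criteria
import Summits.KontsevichZagierPeriods.Zeta5Search.ApproximationCertificate
import Summits.KontsevichZagierPeriods.Zeta5Search.RecurrenceCertificate
import Summits.KontsevichZagierPeriods.Zeta5Search.EffectiveMeasure
import HarnessLib

/-!
# ζ(5) search — certificates ⇒ irrationality MEASURE (cell `pub-zeta5`, TYPER)

HONEST FRAMING: systematic search; no irrationality claim unless certified.

`CRITERIA.md` C4 wired to the certificate structures: a hit of the search does not only prove
`ξ ∉ ℚ`, it bounds the irrationality exponent of `ξ`. All PROVED, by feeding the structures'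
eventual bounds into `exists_measure_of_eventual_rates` (`EffectiveMeasure.lean`, the tree's
Chen–Voutier lemma behind it):

* `ApproximationCertificate.exists_measure` (FORMAT A): if in addition the Casoratian is non-zero
  for ALL large `n` (automatic for recurrences, `RecurrenceCertificate.casoratian_ne_zero`), then
  `∃ C > 0, ∀ a, ∀ b ≠ 0, C / |b|^{(Q'+δ)/μ₁ + 1} < |ξ - a/b|` with `μ₁ = marginValue`; hence
  `¬ LiouvilleWith p ξ` for `p > 1 + (Q'+δ)/μ₁` (`ApproximationCertificate.not_liouvilleWith`);
* `RecurrenceCertificate.exists_measure`, `RecurrenceCertificate.not_liouvilleWith` — unconditional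
  for the finitary recurrence certificate;
* `LinearFormCertificate.exists_measure` (FORMAT B): the structure records no growth of the
  coefficients, so the growth `|b n| ≤ k e^{Q n}` and the non-proportionality
  `a n b (n+1) ≠ a (n+1) b n` (eventually) are extra hypotheses; exponent `1 + Q/(c + φ - δ)`.

In Brown–Zudilin's normalisation: worthiness `γ = 1 + μ₁/Q_tot`, exponent `γ/(γ-1)`.
-/

noncomputable section

open Filter Topology Finset
open Literature.NumberTheory.Transcendental

namespace Summit.KontsevichZagierPeriods.Zeta5Search

namespace ApproximationCertificate

variable {ξ : ℝ} (cert : ApproximationCertificate ξ)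

/-- **FORMAT A ⇒ measure.** An approximation certificate whose Casoratian is non-zero for all
large `n` yields `C > 0` with `C / |b|^{(Q'+δ)/μ₁ + 1} < |ξ - a/b|` for all integers `a` and
`b ≠ 0` (`μ₁ = 2Q - Q' - w - δ` the margin, `Q' + δ` the growth of the integer coefficients
`D n u n`). -/
theorem exists_measure
    (hW : ∀ᶠ n : ℕ in atTop, cert.u n * cert.v (n + 1) - cert.u (n + 1) * cert.v n ≠ 0) :
    ∃ C : ℝ, 0 < C ∧ ∀ a b : ℤ, b ≠ 0 →
      C / |(b : ℝ)| ^ ((cert.growthUp + cert.denomRate) / cert.marginValue + 1) < |ξ - a / b| := by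
  classical
  -- integer representatives `q n = D n u n`, `p n = D n v n` (for large `n`)
  set q : ℕ → ℤ := fun n =>
    if h : ∃ z : ℤ, (cert.denom n : ℚ) * cert.u n = z then h.choose else 0 with hq
  set p : ℕ → ℤ := fun n =>
    if h : ∃ z : ℤ, (cert.denom n : ℚ) * cert.v n = z then h.choose else 0 with hp
  have hqR : ∀ᶠ n : ℕ in atTop, (q n : ℝ) = (cert.denom n : ℝ) * cert.u n := by
    filter_upwards [cert.isInt_u] with n hu
    have h : (q n : ℚ) = (cert.denom n : ℚ) * cert.u n := by
      simp only [hq, dif_pos hu]; exact hu.choose_spec.symm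
    exact_mod_cast h
  have hpR : ∀ᶠ n : ℕ in atTop, (p n : ℝ) = (cert.denom n : ℝ) * cert.v n := by
    filter_upwards [cert.isInt_v] with n hv
    have h : (p n : ℚ) = (cert.denom n : ℚ) * cert.v n := by
      simp only [hp, dif_pos hv]; exact hv.choose_spec.symm
    exact_mod_cast h
  have hshift : Tendsto (fun n : ℕ => n + 1) atTop atTop := tendsto_add_atTop_nat 1
  -- the constants
  set C₀ : ℝ := cert.casoratiConst * Real.exp (-cert.growthLow) /
      (1 - Real.exp (cert.casoratiRate - 2 * cert.growthLow)) with hC₀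
  have hμ := cert.marginValue_pos
  have hQ : 0 < cert.growthUp + cert.denomRate := by
    linarith [cert.denomRate_nonneg, cert.growthLow_le_growthUp, cert.growthLow_pos]
  refine exists_measure_of_eventual_rates (p := p) (q := q) hμ hQ one_pos
    (lt_max_of_lt_right one_pos : (0 : ℝ) < max C₀ 1) ?_ ?_ ?_
  · -- `|q n| = D n u n ≤ e^{δ n} e^{Q' n}`
    filter_upwards [hqR, cert.growth_lower, cert.growth_upper, cert.denom_le] with n hn hlo hup hD
    have hu0 : (0 : ℝ) < cert.u n := (Real.exp_pos _).trans_le hlo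
    have hD0 : (0 : ℝ) ≤ cert.denom n := by positivity
    rw [hn, abs_of_nonneg (mul_nonneg hD0 hu0.le), one_mul, add_mul, Real.exp_add, mul_comm]
    exact mul_le_mul hup hD hD0 (Real.exp_pos _).le
  · -- `|q n ξ - p n| = |D n (u n ξ - v n)| ≤ C₀ e^{-μ₁ n} ≤ max C₀ 1 · e^{-μ₁ n}`
    filter_upwards [hqR, hpR, cert.eventually_abs_form_le] with n hqn hpn hform
    rw [hqn, hpn]
    have e : (cert.denom n : ℝ) * cert.u n * ξ - (cert.denom n : ℝ) * cert.v n =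
        (cert.denom n : ℝ) * ((cert.u n : ℝ) * ξ - cert.v n) := by ring
    rw [e]
    refine hform.trans ?_
    exact mul_le_mul_of_nonneg_right (le_max_left _ _) (Real.exp_pos _).le
  · -- non-proportionality from the Casoratian: `p n q (n+1) - p (n+1) q n = -D n D (n+1) W n`
    filter_upwards [hqR, hpR, hshift.eventually hqR, hshift.eventually hpR, hW] with n hqn hpn
      hqn1 hpn1 hWn
    intro h
    have h' : ((p n * q (n + 1) : ℤ) : ℝ) = ((p (n + 1) * q n : ℤ) : ℝ) := by rw [h]
    push_cast at h'
    rw [hqn, hpn, hqn1, hpn1] at h'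
    have hD : (cert.denom n : ℝ) ≠ 0 := by exact_mod_cast (cert.denom_pos n).ne'
    have hD1 : (cert.denom (n + 1) : ℝ) ≠ 0 := by exact_mod_cast (cert.denom_pos (n + 1)).ne'
    apply hWn
    have hWR : ((cert.u n * cert.v (n + 1) - cert.u (n + 1) * cert.v n : ℚ) : ℝ) = 0 := by
      push_cast
      have : (cert.denom n : ℝ) * (cert.denom (n + 1) : ℝ) *
          ((cert.u n : ℝ) * cert.v (n + 1) - cert.u (n + 1) * cert.v n) = 0 := by
        linear_combination -h'
      rcases mul_eq_zero.1 this with h0 | h0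
      · exact absurd h0 (mul_ne_zero hD hD1)
      · exact h0
    exact_mod_cast hWR

/-- **FORMAT A ⇒ irrationality exponent.** Under the same hypothesis, `¬ LiouvilleWith p ξ` for
every `p > 1 + (Q'+δ)/μ₁`. -/
theorem not_liouvilleWith
    (hW : ∀ᶠ n : ℕ in atTop, cert.u n * cert.v (n + 1) - cert.u (n + 1) * cert.v n ≠ 0)
    {expo : ℝ} (hexpo : (cert.growthUp + cert.denomRate) / cert.marginValue + 1 < expo) :
    ¬ LiouvilleWith expo ξ := by
  obtain ⟨C, hC, h⟩ := cert.exists_measure hW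
  exact not_liouvilleWith_of_measure hC h hexpo

end ApproximationCertificate

namespace RecurrenceCertificate

variable {ξ : ℝ} (R : RecurrenceCertificate ξ)

/-- **Recurrence certificate ⇒ measure** (unconditional: the Casoratian of a recurrence
certificate never vanishes from `N` on). Exponent `1 + (log Λ + δ₀ + 2ε)/(η - 4ε)` in terms of the
certificate's brackets (`η = 2 log λ - log Λ - log τ - δ₀`, `ε = min (η/5, log λ/2)`). -/
theorem exists_measure :
    ∃ C : ℝ, 0 < C ∧ ∀ a b : ℤ, b ≠ 0 →
      C / |(b : ℝ)| ^ ((R.toApproximationCertificate.growthUp +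
          R.toApproximationCertificate.denomRate) / R.toApproximationCertificate.marginValue + 1) <
        |ξ - a / b| :=
  R.toApproximationCertificate.exists_measure (eventually_atTop.2 ⟨R.N, R.casoratian_ne_zero⟩)

/-- **Recurrence certificate ⇒ irrationality exponent**: `¬ LiouvilleWith p ξ` for every
`p > 1 + (Q' + δ)/μ₁` of the built approximation certificate. -/
theorem not_liouvilleWith {expo : ℝ}
    (hexpo : (R.toApproximationCertificate.growthUp + R.toApproximationCertificate.denomRate) /
      R.toApproximationCertificate.marginValue + 1 < expo) :
    ¬ LiouvilleWith expo ξ :=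
  R.toApproximationCertificate.not_liouvilleWith
    (eventually_atTop.2 ⟨R.N, R.casoratian_ne_zero⟩) hexpo

end RecurrenceCertificate

namespace LinearFormCertificate

variable {ξ : ℝ} (cert : LinearFormCertificate ξ)

/-- **FORMAT B ⇒ measure.** A linear-form certificate together with a growth bound
`|b n| ≤ k e^{Q n}` for its integer coefficients of `ξ` and eventual non-proportionality
`a n b (n+1) ≠ a (n+1) b n` yields `C > 0` with `C / |b|^{Q/μ₁ + 1} < |ξ - a/b|` for all integers
`a` and `b ≠ 0`, `μ₁ = c + φ - δ` the margin. -/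
theorem exists_measure {kc Q : ℝ} (hkc : 0 < kc) (hQ : 0 < Q)
    (hgrowth : ∀ᶠ n : ℕ in atTop, |(cert.coeffXi n : ℝ)| ≤ kc * Real.exp (Q * n))
    (hne : ∀ᶠ n : ℕ in atTop,
      cert.coeffConst n * cert.coeffXi (n + 1) ≠ cert.coeffConst (n + 1) * cert.coeffXi n) :
    ∃ C : ℝ, 0 < C ∧ ∀ a b : ℤ, b ≠ 0 →
      C / |(b : ℝ)| ^ (Q / cert.margin + 1) < |ξ - a / b| := by
  refine exists_measure_of_eventual_rates (p := fun n => -cert.coeffConst n) (q := cert.coeffXi)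
    cert.margin_pos' hQ hkc one_pos hgrowth ?_ ?_
  · -- `|b n ξ - (-a n)| = |a n + b n ξ| = |D n ℓ n / Φ n| ≤ e^{-μ₁ n}`
    filter_upwards [cert.eventually_abs_scaled_le, cert.arith] with n hn harith
    have hΦ : (cert.saving n : ℝ) ≠ 0 := by exact_mod_cast (cert.saving_pos n).ne'
    have e : (cert.coeffXi n : ℝ) * ξ - ((-cert.coeffConst n : ℤ) : ℝ) =
        (cert.denom n : ℝ) * cert.form n / cert.saving n := by
      rw [harith, mul_div_cancel_left₀ _ hΦ]
      push_cast
      ring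
    rw [e, one_mul]
    exact hn
  · filter_upwards [hne] with n hn
    intro h
    apply hn
    linear_combination -h

/-- **FORMAT B ⇒ irrationality exponent**: under the same hypotheses, `¬ LiouvilleWith p ξ` for
every `p > 1 + Q/μ₁`. -/
theorem not_liouvilleWith {kc Q : ℝ} (hkc : 0 < kc) (hQ : 0 < Q)
    (hgrowth : ∀ᶠ n : ℕ in atTop, |(cert.coeffXi n : ℝ)| ≤ kc * Real.exp (Q * n))
    (hne : ∀ᶠ n : ℕ in atTop,
      cert.coeffConst n * cert.coeffXi (n + 1) ≠ cert.coeffConst (n + 1) * cert.coeffXi n)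
    {expo : ℝ} (hexpo : Q / cert.margin + 1 < expo) : ¬ LiouvilleWith expo ξ := by
  obtain ⟨C, hC, h⟩ := cert.exists_measure hkc hQ hgrowth hne
  exact not_liouvilleWith_of_measure hC h hexpo

end LinearFormCertificate

end Summit.KontsevichZagierPeriods.Zeta5Search
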